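import Summits.AnomalousDissipation.AnomalousDissipation.Theorems.BaireTransferRobustLoudUpgradeLine
import Summits.AnomalousDissipation.AnomalousDissipation.Theorems.BaireTransferRobustLoudUpgradeStubSteadyPersist
import Literature.Analysis.FluidPDE.LinearizedNSTorus
import Literature.Analysis.FluidPDE.LerayProjectorTorusProofs
import Literature.Analysis.FunctionSpaces.TorusFluidGlue
import Literature.Analysis.FluidPDE.PeriodicNSOrbitPersists

/-!
# Sub-goal `periodicPersist_of_henry` of the line `malkin-cone-group-orbits`
# (crux stmt-AnomalousDissipation-1144, `BaireTransfer.RobustLoudUpgrade`, lead's reshape v3)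

The registered stub `stub_periodicPersist : ∀ S a E ε, nondegPeriodic S a E ε ⊆ persistPeriodic S a E ε`
is, verbatim, the persistence of a NONDEGENERATE time-periodic orbit of the Navier–Stokes flow on
`T³` under a small change of the finitely many force coefficients, at fixed viscosity — D. Henry's
perturbation theorem for periodic orbits of semilinear parabolic equations whose Floquet multiplier
`1` is simple (LNM 840, Ch. 8), a published theorem the tree does not yet contain (no period map /
Floquet theory / periodic-parabolic Fredholm theory for NS on the torus).  This file lands the
REDUCTION of the stub to that theorem:

* `Literature.Analysis.FluidPDE.PeriodicNSOrbitPersists` — Henry's theorem for `NS_ν` on `T³` as a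
  cited Literature `Prop` (file `Literature/Analysis/FluidPDE/PeriodicNSOrbitPersists.lean`, p82832);
* the force map `c ↦ f_c` of the line: differences and SUP-NORM continuity in the coefficient
  vector (`exists_forall_norm_force_sub_le`); smoothness, zero divergence and zero mean are the
  sibling stub's `SteadyPersist.isSmooth_force'` / `isDivFree_force'` / `hasZeroMean_force'`;
* `periodicPersist_of_henry : PeriodicNSOrbitPersists → ∀ S a E ε, nondegPeriodic ⊆ persistPeriodic`:
  for `c ∈ nondegPeriodic` the two nondegeneracy clauses of the class (`linPeriodicSol`,
  `velocityDot` unfolded) are literally the hypotheses (i), (ii) of the theorem, and sup-norm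
  continuity of `c' ↦ f_{c'}` converts its force-ball into a coefficient-ball, which is
  `PeriodicPersistsAt`.

References: D. Henry, *Geometric Theory of Semilinear Parabolic Equations*, LNM 840 (1981), Ch. 8
(§8.2 orbital stability / nondegeneracy, §8.3 perturbation of periodic solutions), with §7.2
(compact period map, Floquet multipliers) and Ch. 3 §3.3–3.5 (the `X^α` semiflow; Navier–Stokes in
dimension `≤ 3` is a worked example); G. Iooss, Arch. Rational Mech. Anal. 47 (1972) 301–329;
V. I. Yudovich, *The Linearization Method in Hydrodynamical Stability Theory* (1989), Ch. II;
J. K. Hale, L. T. Magalhães, W. M. Oliva, *Dynamics in Infinite Dimensions* (2002), Ch. 11 p. 290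
(nondegenerate periodic orbit := multiplier `1` simple; persistence with continuous period);
patterns from `Cruxes/RobustLoudUpgrade/Disproof.lean` §2 (force map).
-/

-- `Summit.<Summit>.<Problem>` is the tree's mandated summit-side namespace (CONVENTIONS §2); for this
-- single-conjunct summit the two coincide, so the duplicate is deliberate.
set_option linter.dupNamespace false

noncomputable section

open scoped BigOperators Topology
open Filter Set Function TopologicalSpace MeasureTheory

namespace Summit.AnomalousDissipation.AnomalousDissipation.Theorems.RobustLoudUpgrade.PeriodicPersistOfHenry

open Literature.Analysis.FunctionSpaces Literature.Analysis.FunctionSpaces.Torus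
open Literature.Analysis.FluidPDE

/-! ## §1 The published theorem: `Literature.Analysis.FluidPDE.PeriodicNSOrbitPersists` (landed p82832,
relocated by the gate from the first submission of this file; Henry 1981, LNM 840, Ch. 8 §8.2–8.3) -/

/-! ## §2 The force map `c ↦ f_c`: differences and sup-norm continuity -/

section Force

variable {S : Finset (Fin 3 → ℤ)}

/-- The Leray multiplier respects differences. [folklore] -/
theorem lerayCoeff_sub (k : Fin 3 → ℤ) (v w : EuclideanSpace ℂ (Fin 3)) :
    Torus.lerayCoeff k (v - w) = Torus.lerayCoeff k v - Torus.lerayCoeff k w := by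
  have h := Torus.lerayCoeff_add k (v - w) w
  rw [sub_add_cancel] at h
  rw [h, add_sub_cancel_right]

-- pattern from Cruxes/RobustLoudUpgrade/Disproof.lean §2 (`force_add`)
/-- `c ↦ f_c` respects differences. [folklore] -/
theorem force_sub (c c' : Coeff S) : force S (c - c') = force S c - force S c' := by
  unfold force
  rw [← realTrigPoly_sub]
  refine realTrigPoly_congr fun k _ => ?_
  rw [Pi.sub_apply, coeffExt_sub, Pi.sub_apply, lerayCoeff_sub]

/-- The real part `ℂ³ → ℝ³` is a contraction. [folklore] -/
theorem norm_realPart_le (w : EuclideanSpace ℂ (Fin 3)) : ‖EuclideanSpace.realPart w‖ ≤ ‖w‖ := by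
  rw [EuclideanSpace.norm_eq, EuclideanSpace.norm_eq]
  gcongr with i
  simp only [EuclideanSpace.realPart_apply, Real.norm_eq_abs]
  exact Complex.abs_re_le_norm (w i)

/-- Sup-norm bound of the force by its coefficients: `‖f_c(x)‖ ≤ ∑ₖ ‖P_k ĉ_k‖`. [folklore] -/
theorem norm_force_le (c : Coeff S) (x : UnitAddTorus (Fin 3)) :
    ‖force S c x‖ ≤ ∑ k ∈ S, ‖Torus.lerayCoeff k (coeffExt S c k)‖ := by
  unfold force
  rw [realTrigPoly_apply, trigPoly_apply]
  refine (norm_realPart_le _).trans ((norm_sum_le _ _).trans (Finset.sum_le_sum fun k _ => ?_))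
  rw [norm_smul]
  have h1 : ‖UnitAddTorus.mFourier k x‖ ≤ 1 := by
    have := (UnitAddTorus.mFourier k).norm_coe_le_norm x
    rwa [UnitAddTorus.mFourier_norm] at this
  exact mul_le_of_le_one_left (norm_nonneg _) h1

/-- The Leray multiplier is continuous in the coefficient. [folklore] -/
theorem continuous_lerayCoeff (k : Fin 3 → ℤ) :
    Continuous fun v : EuclideanSpace ℂ (Fin 3) => Torus.lerayCoeff k v := by
  by_cases hk : k = 0
  · subst hk
    simp only [Torus.lerayCoeff_zero]
    exact continuous_const
  · have h : (fun v : EuclideanSpace ℂ (Fin 3) => Torus.lerayCoeff k v) =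
        fun v : EuclideanSpace ℂ (Fin 3) =>
          v - ((∑ i, (k i : ℂ) * v i) / (freqNormSq k : ℂ)) • WithLp.toLp 2 fun i => (k i : ℂ) := by
      funext v
      rw [Torus.lerayCoeff, if_neg hk]
    rw [h]
    have h1 : Continuous fun v : EuclideanSpace ℂ (Fin 3) =>
        (∑ i, (k i : ℂ) * v i) / (freqNormSq k : ℂ) :=
      Continuous.div_const (continuous_finsetSum _ fun i _ =>
        continuous_const.mul (PiLp.continuous_apply 2 _ i)) _
    exact continuous_id.sub (h1.smul continuous_const)

/-- The coefficient bound `c ↦ ∑ₖ ‖P_k ĉ_k‖` is continuous on `P_S`. [folklore] -/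
theorem continuous_coeffBound :
    Continuous fun c : Coeff S => ∑ k ∈ S, ‖Torus.lerayCoeff k (coeffExt S c k)‖ := by
  refine continuous_finsetSum _ fun k hk => ((continuous_lerayCoeff k).comp ?_).norm
  have h : (fun c : Coeff S => coeffExt S c k) = fun c => c ⟨k, hk⟩ := by
    funext c
    exact coeffExt_of_mem c hk
  rw [h]
  exact continuous_apply _

/-- **Sup-norm continuity of `c ↦ f_c`**: for every `r > 0` there is `ρ > 0` with
`‖f_{c'}(x) − f_c(x)‖ ≤ r` for all `x` whenever `dist c' c < ρ`. [folklore] -/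
theorem exists_forall_norm_force_sub_le (c : Coeff S) {r : ℝ} (hr : 0 < r) :
    ∃ ρ : ℝ, 0 < ρ ∧ ∀ c' : Coeff S, dist c' c < ρ → ∀ x, ‖force S c' x - force S c x‖ ≤ r := by
  have hc := (continuous_coeffBound (S := S)).tendsto (0 : Coeff S)
  have h0 : (∑ k ∈ S, ‖Torus.lerayCoeff k (coeffExt S (0 : Coeff S) k)‖) = 0 := by
    refine Finset.sum_eq_zero fun k _ => ?_
    have : coeffExt S (0 : Coeff S) k = 0 := by
      by_cases hk : k ∈ S
      · rw [coeffExt_of_mem _ hk]; rfl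
      · exact coeffExt_of_not_mem _ hk
    rw [this]
    have hz : Torus.lerayCoeff k (0 : EuclideanSpace ℂ (Fin 3)) = 0 := by
      have := Torus.lerayCoeff_add k (0 : EuclideanSpace ℂ (Fin 3)) 0
      rw [add_zero] at this
      exact left_eq_add.mp this
    rw [hz, norm_zero]
  rw [h0] at hc
  obtain ⟨ρ, hρ, hball⟩ := Metric.tendsto_nhds_nhds.1 hc r hr
  refine ⟨ρ, hρ, fun c' hc' x => ?_⟩
  have hd : dist (c' - c) 0 < ρ := by rwa [dist_zero_right, ← dist_eq_norm]
  have h1 := hball hd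
  rw [Real.dist_eq, sub_zero, abs_of_nonneg (Finset.sum_nonneg fun k _ => norm_nonneg _)] at h1
  rw [← Pi.sub_apply (force S c') (force S c) x, ← force_sub]
  exact (norm_force_le (c' - c) x).trans h1.le

end Force

/-! ## §3 The registered sub-goal: `stub_periodicPersist` from Henry's theorem -/

/-- **`stub_periodicPersist` follows from Henry's persistence theorem** (`PeriodicNSOrbitPersists`):
for `c ∈ nondegPeriodic` the two nondegeneracy clauses of the class are literally the hypotheses
(i), (ii) of the theorem (`linPeriodicSol`, `velocityDot` unfolded), `c' ↦ f_{c'}` is sup-norm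
continuous (`exists_forall_norm_force_sub_le`) with smooth, solenoidal, mean-zero values, so the
force-ball of the theorem contains a coefficient-ball: this is `PeriodicPersistsAt S c ν τ u`, and
the witness itself supplies the rest of `persistPeriodic`. [folklore] -/
theorem periodicPersist_of_henry : PeriodicNSOrbitPersists → ∀ (S : Finset (Fin 3 → ℤ)) (a E ε : ℝ), nondegPeriodic S a E ε ⊆ persistPeriodic S a E ε := by
  intro H S a E ε c hc
  obtain ⟨ν, hν, hνa, τ, u, p, hτ, hsol, hper, hE, hε, hA, hB⟩ := hc
  refine ⟨ν, hν, hνa, τ, u, p, hτ, hsol, hper, hE, hε, fun δ hδ => ?_⟩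
  -- the two nondegeneracy clauses, unfolded
  have hA' : ∀ (w : ℝ → UnitAddTorus (Fin 3) → EuclideanSpace ℂ (Fin 3))
      (q : ℝ → UnitAddTorus (Fin 3) → ℂ), IsSmoothSpaceTimeOn Set.univ w →
      IsSmoothSpaceTimeOn Set.univ q → (∀ t, Torus.IsDivFreeC (w t)) →
      (∀ t, HasZeroMean (w t)) → Function.Periodic w τ →
      (∀ t x, Torus.timeDerivWithin Set.univ w t x = Torus.linearizedNSOperator ν (u t) (w t) (q t) x) →
      ∃ z : ℂ, ∀ t x, w t x = z • Torus.realToComplex (Torus.timeDerivWithin Set.univ u t x) := by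
    intro w q hw hq hdiv hmean hperw heq
    have hmem : w ∈ linPeriodicSol ν u τ 0 :=
      ⟨hw, hdiv, hmean, hperw, q, hq, fun t x => by rw [heq t x, Pi.zero_apply, Pi.zero_apply, add_zero]⟩
    obtain ⟨z, hz⟩ := hA w hmem
    exact ⟨z, fun t x => by rw [hz]; rfl⟩
  have hB' : ∀ (w : ℝ → UnitAddTorus (Fin 3) → EuclideanSpace ℂ (Fin 3))
      (q : ℝ → UnitAddTorus (Fin 3) → ℂ), IsSmoothSpaceTimeOn Set.univ w →
      IsSmoothSpaceTimeOn Set.univ q → (∀ t, Torus.IsDivFreeC (w t)) →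
      (∀ t, HasZeroMean (w t)) → Function.Periodic w τ →
      ∃ t x, Torus.timeDerivWithin Set.univ w t x ≠
        Torus.linearizedNSOperator ν (u t) (w t) (q t) x +
          Torus.realToComplex (Torus.timeDerivWithin Set.univ u t x) := by
    intro w q hw hq hdiv hmean hperw
    by_contra hne
    push Not at hne
    have hmem : w ∈ linPeriodicSol ν u τ (velocityDot u) := ⟨hw, hdiv, hmean, hperw, q, hq, hne⟩
    rw [hB] at hmem
    exact hmem
  obtain ⟨r, hr, hf'⟩ := H ν τ (force S c) u p hν hτ hsol hper hA' hB' δ hδ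
  obtain ⟨ρ, hρ, hforce⟩ := exists_forall_norm_force_sub_le c hr
  refine ⟨ρ, hρ, fun c' hc' => ?_⟩
  exact hf' (force S c') (SteadyPersist.isSmooth_force' c') (SteadyPersist.isDivFree_force' c')
    (SteadyPersist.hasZeroMean_force' c') (hforce c' hc')

end Summit.AnomalousDissipation.AnomalousDissipation.Theorems.RobustLoudUpgrade.PeriodicPersistOfHenry

end
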